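import Mathlib
import Summits.ValiantsHypothesis.ValiantsHypothesis.Theses.ValuativeGCT
import Summits.ValiantsHypothesis.ValiantsHypothesis.Theorems.ValuativeGCTValuativeFlipFirstRungBiteCentres
import Summits.ValiantsHypothesis.ValiantsHypothesis.Theorems.ValuativeGCTValuativeBound

/-!
# `ValuativeGCT.ValuativeFlip` (stmt-ValiantsHypothesis-12624), det census — THE SYMMETRIC KRONECKER BOUND FOR
# `K_m` IS STRICT SOMEWHERE IN DEGREE 2, AT EVERY `m ≥ 3`

Det-orbit-closure multiplicity bound (wall-breaker axis "det-orbit-closure multiplicity bounds for the det census").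
BLMW 2011 Prop. 5.2.1 bounds the multiplicity `K_m(λ*)` of `λ*` in `ℂ[Δ(det_m)]` by the symmetric Kronecker count, which
in the tree is the census space `T₀(λ*) = Hom_{mδ} ⊓ (Stab_End(det_m)-invariants) ⊓ (B-semi-invariants of weight λ*)`
(`ValuativeBound` at threshold `0`; `stabInv_eq_explicit`: `dim T₀(λ*) = sk(λ; δ^m)`).  BLMW §5 note that the bound is
not sharp at `m = 3`, `δ = 2` (type `(2,2,2)`).  Uniformly:

* `exists_orbitMultiplicity_det_lt_census` — for EVERY `m ≥ 3` there is `λ ⊢ 2m` (`≤ m²` parts) with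
  `K_m(λ*) < dim T₀(λ*)` in degree `m · 2`: the route's valuative bound `K_m(λ*) ≤ dim T_U(2(m-r), λ*)`
  (`ValuativeBound.ValuativeBound_proof`, crux stmt-12625, PROVED) for the admissible corner centre `U = Λ_3 ⊕ D_{m-3}`,
  `r = m - 1`, composed with the first-rung bite `dim T_U(2(m-r), λ*) < dim T_U(0, λ*) = dim T₀(λ*)`
  (`firstRung_admissibleCentre_bites`).  Reading: in the lowest degree where the census is not spanned by closure
  functions, some `Stab(det_m)`-invariant highest-weight class of `ℂ[End W]` — a level-2 Domokos–Zubkov invariant, which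
  does not vanish on an Edmonds-gap locus while every pulled-back closure function does — is missing from `ℂ[Δ(det_m)]`,
  at every size `m ≥ 3`; by `ValuativeGCTValuativeFlipIntegralCutNormalization` it is missing from the weight part of the
  NORMALISATION as well (`K̃_m(λ*) ≤ dim T_U`).

References: BLMW, SIAM J. Comput. 40 (2011) §5.2, Prop. 5.2.1 and the remark after it (arXiv:0907.2850);
P. Bürgisser, C. Ikenmeyer, J. Hüttenhain, *Permanent versus determinant: not via saturations*, Proc. AMS 145 (2017)
(arXiv:1501.05528) and *Fundamental invariants of orbit closures*, J. Algebra 477 (2017) (arXiv:1511.02927) (non-normality of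
`Δ(det_m)`); M. Domokos, A. N. Zubkov, Transform. Groups 6 (2001) Thm. 1.1.
-/

namespace Summit.ValiantsHypothesis.ValiantsHypothesis.Theorems.ValuativeFlip

open Literature.NumberTheory.DiophantineGeometry Literature.Computability.AlgebraicComplexity
open MvPolynomial
open scoped BigOperators Matrix

-- `Summit.ValiantsHypothesis.ValiantsHypothesis.…` is the tree's mandated single-conjunct layout (Sub = Summit).
set_option linter.dupNamespace false

noncomputable section

/-- Dropping the trivial valuative factor `I ^ 0 = ⊤` does not change the dimension. [folklore] -/
theorem frk_finrank_inf_pow_zero {σ : Type*} (Hom S₁ S₂ : Submodule ℂ (MvPolynomial σ ℂ)) (I : Ideal (MvPolynomial σ ℂ)) :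
    Module.finrank ℂ ↥(Hom ⊓ (I ^ 0).restrictScalars ℂ ⊓ S₁ ⊓ S₂) = Module.finrank ℂ ↥(Hom ⊓ S₁ ⊓ S₂) := by
  have h : Hom ⊓ (I ^ 0).restrictScalars ℂ ⊓ S₁ ⊓ S₂ = Hom ⊓ S₁ ⊓ S₂ := by
    rw [pow_zero, Ideal.one_eq_top, Submodule.restrictScalars_top, inf_top_eq]
  exact congrArg (fun S : Submodule ℂ (MvPolynomial σ ℂ) => Module.finrank ℂ ↥S) h

/-- **The symmetric Kronecker bound for `K_m` is strict somewhere in degree `2`, at every `m ≥ 3`.**  For every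
`m ≥ 3` there is `λ ⊢ m · 2` with at most `m²` parts such that the multiplicity of `λ* = (dualOfPartition (m·m) λ).toMatIdx`
in `ℂ[Δ(det_m)]` is STRICTLY smaller than the dimension of the census space
`T₀(λ*) = Hom_{2m} ⊓ (Stab_End(det_m)-invariants) ⊓ (B-semi-invariants of weight λ*)` (the symmetric Kronecker space).
Proof: `ValuativeBound_proof` at the admissible corner centre + `firstRung_admissibleCentre_bites` + `I^0 = ⊤`.
[BLMW 2011 Prop. 5.2.1 + remark; folklore] -/
theorem exists_orbitMultiplicity_det_lt_census (m : ℕ) [NeZero m] (h3 : 3 ≤ m) :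
    ∃ lam : Nat.Partition (m * 2), lam.parts.card ≤ m * m ∧
      orbitMultiplicity ℂ (detFormLex ℂ m) m ((Weight.dualOfPartition (m * m) lam).toMatIdx) <
        Module.finrank ℂ ↥(MvPolynomial.homogeneousSubmodule (MatIdx m × MatIdx m) ℂ (m * 2)
          ⊓ (⨅ (M : Matrix (MatIdx m) (MatIdx m) ℂ)
              (_ : linSubst (MatIdx m) ℂ M (detFormLex ℂ m) = detFormLex ℂ m),
              LinearMap.ker ((MvPolynomial.aeval (R := ℂ) fun p : MatIdx m × MatIdx m =>
                ∑ l : MatIdx m, M l p.2 • MvPolynomial.X (p.1, l)).toLinearMap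
                - LinearMap.id (R := ℂ) (M := MvPolynomial (MatIdx m × MatIdx m) ℂ)))
          ⊓ (⨅ (g : Matrix.GeneralLinearGroup (MatIdx m) ℂ) (_ : IsUpperTriangular g),
              LinearMap.ker ((MvPolynomial.aeval (R := ℂ) fun p : MatIdx m × MatIdx m =>
                ∑ l : MatIdx m, ((g⁻¹ : Matrix.GeneralLinearGroup (MatIdx m) ℂ) :
                  Matrix (MatIdx m) (MatIdx m) ℂ) p.1 l • MvPolynomial.X (l, p.2)).toLinearMap
                - weightChar ((Weight.dualOfPartition (m * m) lam).toMatIdx) g •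
                  LinearMap.id (R := ℂ) (M := MvPolynomial (MatIdx m × MatIdx m) ℂ)))) := by
  obtain ⟨U, r, hU, _hr, lam, hcard, hlt⟩ := firstRung_admissibleCentre_bites m h3
  refine ⟨lam, hcard, ?_⟩
  have hB := ValuativeBound.ValuativeBound_proof m U r hU 2 lam hcard
  dsimp only at hB hlt
  exact lt_of_le_of_lt hB (lt_of_lt_of_eq hlt (frk_finrank_inf_pow_zero _ _ _ _))

end

end Summit.ValiantsHypothesis.ValiantsHypothesis.Theorems.ValuativeFlip
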